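import Summits.NavierStokesRegularity.FluidComputer.LeraySpeedLimit
import HarnessLib

/-!
# Fluid computer — the TIME FACE of the level dictionary, VI: the inverse-square enstrophy falls at most linearly (L24′)

HONEST FRAMING (cell `pub-fluidc`, verbatim): *low prior, high value-of-information experiment on Tao's
machine paradigm; NOT a claim that NS blows up.* Theorem side of the cell; nothing here is evidence of blow-up.
The GLOBAL form of the speed limit (`LeraySpeedLimit.speed_limit`, L24, which speaks about windows inside
Leray's local lifespan): chaining the local statement along a uniform partition of `[a, b]` (the enstrophy is
bounded on compact sub-intervals of `(0, T)`, `IsMaximalSmoothSolution.isH1RegularOn_Ioo`) removes the window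
hypothesis. For every maximal smooth solution `(u, p)` of the unforced Navier–Stokes system on `ℝ³ × [0, T)`
(`ν > 0`) which is Leray–Hopf from `u 0`, with `Z(t) = ∫|∇u(t)|²` (finite and positive on `(0, T)`):

* `inv_sq_enstrophy_sub_le` (**L24′, THE SPEED LIMIT, GLOBAL FORM**) — an absolute `κ > 0` with
  `Z(a)⁻² − Z(b)⁻² ≤ 2κν⁻³ (b − a)` for ALL `0 < a ≤ b < T`: the inverse-square enstrophy cannot fall faster than
  at the rate `2κ/ν³` (`t ↦ Z(t)⁻² + 2κν⁻³ t` is non-decreasing on `(0, T)`); climbing from enstrophy `Z₁` to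
  `Z₂` takes at least `ν³ (Z₁⁻² − Z₂⁻²)/(2κ)`, however the cascade is organised. Letting `b → T` (where
  `Z(b)⁻² → 0` by the countdown) it re-proves the countdown with `c = 1/(2κ)`; read forward from `a` it is the
  dictionary's answer to 'how fast can the machine's clock possibly run': NOT FASTER THAN BERNOULLI's
  `Z' ≤ κν⁻³Z³`.

HONEST SIZE NOTE: `κ` inexplicit. FIXED-WINDOW statement about two finite times: in form it is checkable
against any measured enstrophy curve of the atlas (the word is '`Z⁻²` falls at most linearly'), the number is
not. Necessity only. 0 sorry; no new definitions, no named facts.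

## References

* J. Leray, Acta Math. 63 (1934) 193–248, §20. [Leray1934]
* J. C. Robinson, J. L. Rodrigo, W. Sadowski, *The Three-Dimensional Navier–Stokes Equations*, CUP 2016,
  Thm. 6.8 (proof, (6.7)–(6.9)), Lemma 6.11. [RobinsonRodrigoSadowski2016]
-/

noncomputable section

open MeasureTheory Set Function Filter Topology Metric
open scoped ENNReal NNReal RealInnerProductSpace
open Literature.Analysis.FluidPDE Literature.Analysis.FunctionSpaces
open Summit.NavierStokesRegularity.FluidComputer.LerayClock

namespace Summit.NavierStokesRegularity.FluidComputer.LerayInverseEnstrophy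

/-- **L24′ — THE INVERSE-SQUARE ENSTROPHY FALLS AT MOST LINEARLY (global speed limit).** There is an absolute
`κ > 0` such that for every `ν > 0`, `T > 0` and every maximal smooth solution `(u, p)` of the unforced
Navier–Stokes system on `ℝ³ × [0, T)` which is Leray–Hopf from `u 0`, with `Z(t) = ∫|∇u(t)|²`: for ALL
`0 < a ≤ b < T`, `Z(a) > 0`, `Z(b) > 0` and `(Z(a)²)⁻¹ − (Z(b)²)⁻¹ ≤ 2κν⁻³ (b − a)`. Proof: the local speed limit
`LeraySpeedLimit.speed_limit` in inverse form on each step of a uniform partition of `[a, b]` finer than Leray's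
lifespan for the `H¹` bound of `u` on `[a, b]`, and telescoping.
[cite: RobinsonRodrigoSadowski2016, Thm. 6.8 (proof, (6.7)-(6.9)) and Lemma 6.11] [cite: Leray1934, §20] -/
theorem inv_sq_enstrophy_sub_le :
    ∃ κ : ℝ, 0 < κ ∧ ∀ (ν T : ℝ), 0 < ν → 0 < T →
      ∀ (u : ℝ → EuclideanSpace ℝ (Fin 3) → EuclideanSpace ℝ (Fin 3)) (p : ℝ → EuclideanSpace ℝ (Fin 3) → ℝ),
      IsMaximalSmoothSolution ν 0 u p T → IsLerayHopfOn T ν 0 (u 0) u →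
      ∀ a ∈ Ioo 0 T, ∀ b ∈ Ico a T,
        0 < (∫⁻ x, ENNReal.ofReal (frobeniusNormSq (fderiv ℝ (u a) x))).toReal ∧
        0 < (∫⁻ x, ENNReal.ofReal (frobeniusNormSq (fderiv ℝ (u b) x))).toReal ∧
        ((∫⁻ x, ENNReal.ofReal (frobeniusNormSq (fderiv ℝ (u a) x))).toReal ^ 2)⁻¹ -
            ((∫⁻ x, ENNReal.ofReal (frobeniusNormSq (fderiv ℝ (u b) x))).toReal ^ 2)⁻¹ ≤
          2 * κ * (ν ^ 3)⁻¹ * (b - a) := by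
  obtain ⟨κ, c₀, hκ, hc₀, H⟩ := LeraySpeedLimit.speed_limit
  obtain ⟨cW, hcW, HW⟩ := LerayDeadline.leray_window
  refine ⟨κ, hκ, fun ν T hν hT u p hmax hLH a ha b hb => ?_⟩
  set Z : ℝ → ℝ := fun t => (∫⁻ x, ENNReal.ofReal (frobeniusNormSq (fderiv ℝ (u t) x))).toReal with hZ
  set L : ℝ := κ * (ν ^ 3)⁻¹ with hL
  have hL0 : 0 ≤ L := by positivity
  have hpos : ∀ t ∈ Ioo 0 T, 0 < Z t := fun t ht => (HW ν T hν hT u p hmax hLH t ht).1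
  have hbT : ∀ t ∈ Icc a b, t ∈ Ioo 0 T := fun t ht => ⟨ha.1.trans_le ht.1, ht.2.trans_lt hb.2⟩
  refine ⟨hpos a ha, hpos b (hbT b ⟨hb.1, le_rfl⟩), ?_⟩
  -- the local speed limit in inverse form
  have hloc : ∀ t ∈ Icc a b, ∀ t' ∈ Icc t b, Z t ^ 2 * (t' - t) < c₀ * ν ^ 3 →
      (Z t ^ 2)⁻¹ - (Z t' ^ 2)⁻¹ ≤ 2 * L * (t' - t) := by
    intro t ht t' ht' hsmall
    have htI : t ∈ Ioo 0 T := hbT t ht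
    have ht'I : t' ∈ Ico t T := ⟨ht'.1, ht'.2.trans_lt hb.2⟩
    have hx : 0 < Z t := hpos t htI
    have hy : 0 < Z t' := hpos t' (hbT t' ⟨ht.1.trans ht'.1, ht'.2⟩)
    have h := H ν T hν hT u p hmax hLH t htI t' ht'I hsmall
    have e : 2 * κ * (ν ^ 3)⁻¹ = 2 * L := by rw [hL]; ring
    rw [e] at h
    have hx2 : 0 < Z t ^ 2 := by positivity
    have hy2 : 0 < Z t' ^ 2 := by positivity
    by_cases hD : 1 - 2 * L * Z t ^ 2 * (t' - t) ≤ 0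
    · -- then `2 L (t' - t) ≥ (Z t ^ 2)⁻¹`
      have h1 : (Z t ^ 2)⁻¹ ≤ 2 * L * (t' - t) := by
        rw [inv_le_iff_one_le_mul₀ hx2]
        nlinarith [hD]
      have h2 : 0 ≤ (Z t' ^ 2)⁻¹ := by positivity
      linarith
    · rw [not_le] at hD
      have hyD : Z t' ^ 2 ≤ Z t ^ 2 / (1 - 2 * L * Z t ^ 2 * (t' - t)) := by
        rw [le_div_iff₀ hD]
        exact h
      have h1 : (Z t ^ 2 / (1 - 2 * L * Z t ^ 2 * (t' - t)))⁻¹ ≤ (Z t' ^ 2)⁻¹ := inv_anti₀ hy2 hyD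
      have h2 : (Z t ^ 2 / (1 - 2 * L * Z t ^ 2 * (t' - t)))⁻¹ = (Z t ^ 2)⁻¹ - 2 * L * (t' - t) := by
        rw [inv_div, div_eq_iff hx2.ne', sub_mul, inv_mul_cancel₀ hx2.ne']
        ring
      linarith
  -- a uniform bound for `Z` on `[a, b]` (the `H¹` bound of `u` there)
  have hH1 : IsH1RegularOn (Ioo 0 T) u := hmax.isH1RegularOn_Ioo hν hT hLH
  obtain ⟨M, hMtop, hM⟩ := hH1.exists_forall_le (isCompact_Icc : IsCompact (Icc a b)) fun t ht => hbT t ht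
  set Mr : ℝ := M.toReal with hMr
  have hMr0 : 0 ≤ Mr := ENNReal.toReal_nonneg
  have hZM : ∀ t ∈ Icc a b, Z t ≤ Mr := by
    intro t ht
    have hC1 : ContDiff ℝ 1 (u t) :=
      (hmax.1.contDiff_velocity ⟨(hbT t ht).1.le, (hbT t ht).2⟩).of_le (by exact_mod_cast le_top)
    have h1 : (∫⁻ x, ENNReal.ofReal (frobeniusNormSq (fderiv ℝ (u t) x))) ≤ M := by
      rw [← eWeakGradL2Sq_eq_of_hasWeakGradient (hasWeakGradient_fderiv_of_contDiff hC1)]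
      exact le_add_self.trans (hM t ht)
    exact ENNReal.toReal_mono hMtop.ne h1
  -- the step size
  have hcν : 0 < c₀ * ν ^ 3 := by positivity
  set h : ℝ := c₀ * ν ^ 3 / (2 * (Mr ^ 2 + 1)) with hh
  have hhpos : 0 < h := div_pos hcν (by positivity)
  have hstep_ok : ∀ t ∈ Icc a b, ∀ s : ℝ, 0 ≤ s → s ≤ h → Z t ^ 2 * s < c₀ * ν ^ 3 := by
    intro t ht s hs0 hsh
    have hZ0 : 0 ≤ Z t := ENNReal.toReal_nonneg
    calc Z t ^ 2 * s ≤ Mr ^ 2 * h := mul_le_mul (pow_le_pow_left₀ hZ0 (hZM t ht) 2) hsh hs0 (sq_nonneg _)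
      _ < c₀ * ν ^ 3 := by
          rw [hh, mul_div_assoc', div_lt_iff₀ (by positivity)]
          nlinarith [sq_nonneg Mr]
  -- the uniform partition of `[a, b]`
  set n : ℕ := ⌈(b - a) / h⌉₊ + 1 with hn
  have hn0 : 0 < (n : ℝ) := by positivity
  set s : ℝ := (b - a) / n with hs
  have hs0 : 0 ≤ s := div_nonneg (sub_nonneg.2 hb.1) hn0.le
  have hsh : s ≤ h := by
    rw [hs, div_le_iff₀ hn0]
    have h1 : (b - a) / h ≤ ⌈(b - a) / h⌉₊ := Nat.le_ceil _
    have h2 : (⌈(b - a) / h⌉₊ : ℝ) ≤ n := by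
      rw [hn]
      push_cast
      linarith
    have h3 := (div_le_iff₀ hhpos).1 (h1.trans h2)
    linarith
  have hns : (n : ℝ) * s = b - a := by
    rw [hs]
    field_simp
  -- telescoping along the partition
  have hind : ∀ k : ℕ, k ≤ n → (Z a ^ 2)⁻¹ - (Z (a + k * s) ^ 2)⁻¹ ≤ 2 * L * (k * s) := by
    intro k
    induction k with
    | zero =>
      intro _
      simp
    | succ k ih =>
      intro hk
      have hk' : k ≤ n := Nat.le_of_succ_le hk
      have hk1s : ((k : ℝ) + 1) * s ≤ b - a := by
        calc ((k : ℝ) + 1) * s ≤ n * s := mul_le_mul_of_nonneg_right (by exact_mod_cast hk) hs0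
          _ = b - a := hns
      have hks0 : 0 ≤ (k : ℝ) * s := mul_nonneg (Nat.cast_nonneg k) hs0
      have htk : a + k * s ∈ Icc a b := ⟨by linarith, by nlinarith⟩
      have htk1 : a + ((k : ℝ) + 1) * s ∈ Icc (a + k * s) b := ⟨by nlinarith, by linarith⟩
      have hdiff : a + ((k : ℝ) + 1) * s - (a + k * s) = s := by ring
      have hl := hloc (a + k * s) htk (a + ((k : ℝ) + 1) * s) htk1
        (by rw [hdiff]; exact hstep_ok _ htk s hs0 hsh)
      rw [hdiff] at hl
      push_cast
      calc (Z a ^ 2)⁻¹ - (Z (a + ((k : ℝ) + 1) * s) ^ 2)⁻¹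
          = ((Z a ^ 2)⁻¹ - (Z (a + k * s) ^ 2)⁻¹) +
              ((Z (a + k * s) ^ 2)⁻¹ - (Z (a + ((k : ℝ) + 1) * s) ^ 2)⁻¹) := by ring
        _ ≤ 2 * L * (k * s) + 2 * L * s := add_le_add (ih hk') hl
        _ = 2 * L * (((k : ℝ) + 1) * s) := by ring
  have hfin := hind n le_rfl
  rw [hns, add_sub_cancel] at hfin
  have e : 2 * L * (b - a) = 2 * κ * (ν ^ 3)⁻¹ * (b - a) := by rw [hL]; ring
  linarith [hfin, e]

end Summit.NavierStokesRegularity.FluidComputer.LerayInverseEnstrophy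

end
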